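import Literature.AnabelianGeometry.EtaleTheta.Discharge.Sec5Lem59iiOfBiKummerData
import Literature.AnabelianGeometry.EtaleTheta.Discharge.Sec5OfConnectedTemperoid

/-!
# [EtTh] Lemma 5.9 (ii) — and (i), Prop. 4.3 (iii) — with NO named input: for the CONSTRUCTED `s^trv_N` and over the genuine connected base `B^temp(Π^tp_X)⁰`

Mochizuki, *The étale theta function and its Frobenioid-theoretic manifestations*, Publ. RIMS **45** (2009),
Lemma 5.9 (ii), printed p. 332 (PDF p. 106 of `paper:doi-10-2977-prims-1234361159`):
"We have a natural exact sequence `1 → μ_N(B_N) → E_N → Im(Π^tp_Y) → 1` — where `Im(Π^tp_Y)` denotes the image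
of `Π^tp_Y ⊆ Π^tp_X` via the natural outer homomorphism `Π^tp_X ↠ Aut_D(B_N^bs)`"; proof (p. 332): "Immediate from
the definitions". [cite: MochizukiEtTh2009, Lem 5.9 (ii) p.332 (PDF p.106)]

abc-iut cell, cone nodes `EtTh:Lem5.9(ii)` / `EtTh:Lem5.9(i)` / `EtTh:Prop4.3(iii)` (kernel indices `Summit.ABC.IUTFork.DAG.N_EtTh_Lem5_9_ii`,
`N_EtTh_Lem5_9_i`, `N_EtTh_Prop4_3_iii`), seat abc-iut-w6-d054
(W6 tranche 2, generation 2).  PROOF-ONLY companion (no definitions, no instances, no new `Prop` facts); nothing landed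
is edited.  Sequel of `Discharge/Sec5Lem59iiOfBiKummerData.lean` (p431423), which proves `ENExact` at the assembled §5 data
`ofRootData` / `ofBiKummerData` MODULO the one printed input those constructors carry as a hypothesis: the section
property `hσ` of `σ = s^trv_N : Aut_D(A_N^bs) → Aut_C(A_N)` ([FrdI] Prop. 5.6).

THIS FILE removes that input, BY NAME:
* `s^trv_N` is CONSTRUCTED for the assembled data as `ThetaFrobenioid.strvOfBiKummerData h R` (abc-iut-L2-t4,
  `FrobenioidThetaBaseSection.lean`: the zero section `g ↦ (1, g, 0, 1)` of `(A_N^bs, 0)` in the model Frobenioid of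
  [FrdI] Thm. 5.2, transported to the Frobenius-trivial `A_N` along [FrdI] Thm. 5.1 (iii)), and its section property is
  the THEOREM `baseMap_strvOfBiKummerData` — so for `σ := s^trv_N` as built, Lemma 5.9 (ii) holds at `ofBiKummerData`
  with no `hσ` (`enExact_ofBiKummerData_strv`);
* over the GENUINE connected base `D := B^temp(Π^tp_X)⁰` (Def. 3.6 (ii): connected, totally epimorphic) abc-iut-L2-t4's
  `ofConnectedTemperoidData` (`Discharge/Sec5OfConnectedTemperoid.lean`) discharges `hopen`, takes `σ := strvOfBiKummerData`,
  and derives `hdivc` / `hdivp` from the printed divisor invariances `hinvc` (p. 330: "`Div(s^⊓_N)` descends to `Φ(A_⊚)`")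
  / `hinvp` (Prop. 4.3 (i) proof, p. 317) — there Lemma 5.9 (ii) holds outright (`enExact_ofConnectedTemperoidData`, with
  the surjectivity clause `EN_map_autBase_ofConnectedTemperoidData`, the kernel clause `EN_inf_ker_ofConnectedTemperoidData`,
  and the three-clause package `lem59ii_ofConnectedTemperoidData` including `μ_N(B_N) ≤ E_N`);
* Prop. 4.3 (iii) (`BiKummerDifferenceMem`, the `μ_N(B_N)`-valued bi-Kummer difference of `(s^⊓-gp_N, s^⊔-gp_N)`, p. 331) and
  hence Lemma 5.9 (i) (`SectionsFactor`: "`s^⊓-gp_N|_{H_{B_N}}`, `s^⊔-gp_N` factor through `E_N`") hold over `B^temp(Π^tp_X)⁰`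
  MODULO the single printed input `hH` (`Π^tp_Ÿ ⊆ H_⊙`, §5 p. 322) — `hσ` and the [FrdI] Thm. 5.2 (ii) dictionary laws being
  theorems (`biKummerDifferenceMem_ofConnectedTemperoidData`, `sectionsFactor_ofConnectedTemperoidData`) — and with NO input at all
  for the canonical choice `A_⊙^bs := Ÿ` (`BiKummerSetting.mkOfConnectedTemperoidYdd`, where `hH` is abc-iut-L2-t4's theorem
  `hH_mkOfConnectedTemperoidYdd`): `biKummerDifferenceMem_ofConnectedTemperoidYddData`, `sectionsFactor_ofConnectedTemperoidYddData`,
  `enExact_ofConnectedTemperoidYddData`, packaged as `lem59_i_ii_ofConnectedTemperoidYddData`.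
Remaining binders are the data's own: `h` ([FrdI] Thm. 5.2 hypotheses on `Φ`, `B`), the subquotient stub `Q`, the roots
`Rl`, `R`, the identification `ιX`, the constants `constEmb`, and `hinvc` / `hinvp` (resp. `hdivc` / `hdivp`) — no section
hypothesis, no `Facts` bundle, no FACT-LIST name.
HONEST FRAMING: [EtTh] is refereed; kernel-checked implications over the cell's typed §3–§5 data structures, whose parameter
class `TemperedFrobenioid T₀ (ConnectedPart (BTemp X.Pi)) VD` is not shown inhabited here; nothing here bears on
[IUTchIII] Cor. 3.12 or takes a side; typed ≠ proved for data not of this form.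
-/

noncomputable section

namespace Literature.AnabelianGeometry.EtaleTheta

open CategoryTheory Opposite Literature.AlgebraicGeometry.Frobenioids Literature.AnabelianGeometry.SemiGraphs
  Literature.AnabelianGeometry.SemiGraphs.GaloisObjects Literature.AlgebraicGeometry.Frobenioids.QuasiTemperoid.BTempConnected

namespace ThetaFrobenioid

universe u₀ v₀ u v w

/-! ### Lemma 5.9 (ii) at `ofBiKummerData` with the CONSTRUCTED section `σ := s^trv_N = strvOfBiKummerData h R` -/

section OfBiKummerDataStrv

variable {K : Type u₀} [Field K]
variable {X : SemiGraphs.TemperedArithmeticGroup.{u₀} K} {D₀ : Type u₀} [Category.{v₀} D₀]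
  {V : FrdIMonoidStub.{w}} {T₀ : RealifiedDivisorMonoids (D₀ := D₀) V} {D : Type u} [Category.{v} D]
  {VD : FrdICatStub.{u, v, w} D} {S : BiKummerSetting X T₀ D VD}
  {pullFrac : ∀ {A A' : S.C} (_ : A' ⟶ A), S.biratUnits A → S.biratUnits A'}
  {lv N : ℕ+} {T : ThetaEnvData.{max v w} N} {θ : S.biratUnits S.Aodot} {Bl : S.C}
  {Pl : S.FractionPair θ Bl} {Rl : S.NthRoot θ Pl lv pullFrac}
  (h : ModelFrobenioid.Hypotheses S.tf.divisorMonoid S.tf.ratFnFunctor)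
  (toB : ∀ A : S.C, S.biratUnits A →* S.tf.biratUnitsModel A) (Q : FrobenioidTheta.ThetaSubquotientStub.{w} D)
  (odd_l : Odd (lv : ℕ)) (R : S.NthRoot Rl.root Rl.pair N pullFrac) (ιX : T.PiX ≃ₜ* X.Pi)
  (hopen : IsOpen ((S.galoisSurj R.AN.base R.αData.isGalois).ker : Set X.Pi))
  (K' : Type w) [Field K'] (constEmb : K'ˣ →* S.tf.biratUnitsModel R.BN)
  (constEmb_injective : Function.Injective constEmb)
  (hdivc : ∀ g : Aut R.BN.base,
    ModelFrobenioid.div ((strvOfBiKummerData h R ((BiKummerSetting.NthRoot.baseIso S R).conjAut.symm g)).hom ≫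
      R.pair.num) = ModelFrobenioid.div R.pair.num)
  (hdivp : ∀ y : T.PiYdd,
    ModelFrobenioid.div ((strvOfBiKummerData h R (S.galoisSurj R.AN.base R.αData.isGalois (ιX y.1))).hom ≫ R.pair.den) =
      ModelFrobenioid.div R.pair.den)

/-- **[EtTh] Lemma 5.9 (ii) at the assembled §5 data `ofBiKummerData` with `s^trv_N` CONSTRUCTED** (`σ := strvOfBiKummerData h R`,
the section of the Frobenius-trivial `A_N` from [FrdI] Thm. 5.2 / Thm. 5.1 (iii)): the sequence `1 → μ_N(B_N) → E_N → Im(Π^tp_Y) → 1`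
is exact (`ENExact`) — NO section hypothesis: `hσ` of `enExact_ofBiKummerData` is the theorem `baseMap_strvOfBiKummerData`.
[cite: MochizukiEtTh2009, Lem 5.9 (ii) p.332 (PDF p.106)] -/
theorem enExact_ofBiKummerData_strv :
    (ofBiKummerData h toB Q odd_l R ιX hopen (strvOfBiKummerData h R) K' constEmb constEmb_injective hdivc hdivp).ENExact :=
  enExact_ofBiKummerData h toB Q odd_l R ιX hopen (strvOfBiKummerData h R) K' constEmb constEmb_injective hdivc hdivp
    (baseMap_strvOfBiKummerData h R)

end OfBiKummerDataStrv

/-! ### Lemma 5.9 (ii) over the genuine connected base `B^temp(Π^tp_X)⁰` (`ofConnectedTemperoidData`) -/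

section OfConnectedTemperoidData

variable {K : Type u₀} [Field K] {X : SemiGraphs.TemperedArithmeticGroup.{u₀} K} {D₀ : Type u₀} [Category.{v₀} D₀]
  {V : FrdIMonoidStub.{w}} {T₀ : RealifiedDivisorMonoids (D₀ := D₀) V}
  {VD : FrdICatStub.{u₀ + 1, u₀, w} (ConnectedPart (BTemp X.Pi))}
  {tf : TemperedFrobenioid T₀ (ConnectedPart (BTemp X.Pi)) VD} {hZ : tf.monoidType = MonoidType.Z}
  {hP : ∀ A : (ConnectedPart (BTemp X.Pi))ᵒᵖ, IsPerfect (tf.Φ.carrier A)}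
  {NH : Subgroup (Field.absoluteGaloisGroup K) → tf.category → ℕ+ → Prop} {A₀ : tf.category}
  {hA₀ : PreFrobenioid.IsFrobeniusTrivial tf.toElem A₀} {hA₀' : SemiGraphs.IsGaloisObj A₀.base.obj}
  {pullFrac : ∀ {A A' : (BiKummerSetting.mkOfConnectedTemperoid X tf hZ hP NH A₀ hA₀ hA₀').C} (_ : A' ⟶ A),
    (BiKummerSetting.mkOfConnectedTemperoid X tf hZ hP NH A₀ hA₀ hA₀').biratUnits A →
      (BiKummerSetting.mkOfConnectedTemperoid X tf hZ hP NH A₀ hA₀ hA₀').biratUnits A'}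
  {lv N : ℕ+} {T : ThetaEnvData.{max u₀ w} N}
  {θ : (BiKummerSetting.mkOfConnectedTemperoid X tf hZ hP NH A₀ hA₀ hA₀').biratUnits
    (BiKummerSetting.mkOfConnectedTemperoid X tf hZ hP NH A₀ hA₀ hA₀').Aodot}
  {Bl : (BiKummerSetting.mkOfConnectedTemperoid X tf hZ hP NH A₀ hA₀ hA₀').C}
  {Pl : (BiKummerSetting.mkOfConnectedTemperoid X tf hZ hP NH A₀ hA₀ hA₀').FractionPair θ Bl}
  {Rl : (BiKummerSetting.mkOfConnectedTemperoid X tf hZ hP NH A₀ hA₀ hA₀').NthRoot θ Pl lv pullFrac}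
  (h : ModelFrobenioid.Hypotheses tf.divisorMonoid tf.ratFnFunctor)
  (Q : FrobenioidTheta.ThetaSubquotientStub.{w} (ConnectedPart (BTemp X.Pi))) (odd_l : Odd (lv : ℕ))
  (R : (BiKummerSetting.mkOfConnectedTemperoid X tf hZ hP NH A₀ hA₀ hA₀').NthRoot Rl.root Rl.pair N pullFrac)
  (ιX : T.PiX ≃ₜ* X.Pi) (K' : Type w) [Field K'] (constEmb : K'ˣ →* tf.biratUnitsModel R.BN)
  (constEmb_injective : Function.Injective constEmb)
  (hinvc : ∀ g : Aut R.AN.base,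
    pull tf.divisorMonoid g.hom (ModelFrobenioid.div R.pair.num) = ModelFrobenioid.div R.pair.num)
  (hinvp : ∀ y : T.PiX, y ∈ T.PiYdd →
    pull tf.divisorMonoid ((BiKummerSetting.mkOfConnectedTemperoid X tf hZ hP NH A₀ hA₀ hA₀').galoisSurj R.AN.base
      R.αData.isGalois (ιX y)).hom (ModelFrobenioid.div R.pair.den) = ModelFrobenioid.div R.pair.den)

/-- **[EtTh] Lemma 5.9 (ii) over the GENUINE connected base `B^temp(Π^tp_X)⁰`** (the §5 data `ofConnectedTemperoidData`:
`hopen` discharged, `s^trv_N` constructed, `hdivc`/`hdivp` from the printed divisor invariances): the sequence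
`1 → μ_N(B_N) → E_N → Im(Π^tp_Y) → 1` is exact (`ENExact`), by `enExact_of` and the UNCONDITIONAL section property
`sgpCapSection_ofConnectedTemperoidData` — no named input.  [cite: MochizukiEtTh2009, Lem 5.9 (ii) p.332 (PDF p.106)] -/
theorem enExact_ofConnectedTemperoidData :
    (ofConnectedTemperoidData h Q odd_l R ιX K' constEmb constEmb_injective hinvc hinvp).ENExact :=
  enExact_of _ (sgpCapSection_ofConnectedTemperoidData h Q odd_l R ιX K' constEmb constEmb_injective hinvc hinvp)

/-- Lemma 5.9 (ii) over `B^temp(Π^tp_X)⁰`, SURJECTIVITY clause: the image of `E_N` under `Aut_C(B_N) → Aut_D(B_N^bs)` is exactly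
`Im(Π^tp_Y̲)` (`E_N ↠ Im(Π^tp_Y)`).  [cite: MochizukiEtTh2009, Lem 5.9 (ii) p.332 (PDF p.106)] -/
theorem EN_map_autBase_ofConnectedTemperoidData :
    (ofConnectedTemperoidData h Q odd_l R ιX K' constEmb constEmb_injective hinvc hinvp).EN.map
        ((ofConnectedTemperoidData h Q odd_l R ιX K' constEmb constEmb_injective hinvc hinvp).autBase
          (ofConnectedTemperoidData h Q odd_l R ιX K' constEmb constEmb_injective hinvc hinvp).BN) =
      (ofConnectedTemperoidData h Q odd_l R ιX K' constEmb constEmb_injective hinvc hinvp).imPiY :=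
  (enExact_ofConnectedTemperoidData h Q odd_l R ιX K' constEmb constEmb_injective hinvc hinvp).1

/-- Lemma 5.9 (ii) over `B^temp(Π^tp_X)⁰`, EXACTNESS IN THE MIDDLE: the kernel of `E_N → Im(Π^tp_Y̲)` is the cyclotome,
`E_N ∩ Ker(Aut_C(B_N) → Aut_D(B_N^bs)) = μ_N(B_N)`.  [cite: MochizukiEtTh2009, Lem 5.9 (ii) p.332 (PDF p.106)] -/
theorem EN_inf_ker_ofConnectedTemperoidData :
    (ofConnectedTemperoidData h Q odd_l R ιX K' constEmb constEmb_injective hinvc hinvp).EN ⊓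
        ((ofConnectedTemperoidData h Q odd_l R ιX K' constEmb constEmb_injective hinvc hinvp).autBase
          (ofConnectedTemperoidData h Q odd_l R ιX K' constEmb constEmb_injective hinvc hinvp).BN).ker =
      (ofConnectedTemperoidData h Q odd_l R ιX K' constEmb constEmb_injective hinvc hinvp).muTorsion
        (ofConnectedTemperoidData h Q odd_l R ιX K' constEmb constEmb_injective hinvc hinvp).BN
        (ofConnectedTemperoidData h Q odd_l R ιX K' constEmb constEmb_injective hinvc hinvp).N :=
  (enExact_ofConnectedTemperoidData h Q odd_l R ιX K' constEmb constEmb_injective hinvc hinvp).2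

/-- **The printed exact sequence, all three clauses at once**, over `B^temp(Π^tp_X)⁰`: injectivity side `μ_N(B_N) ≤ E_N`
(`μ_N(B_N) ↪ E_N`; `le_sectionSubgroup`, as in `muTorsion_le_EN`), surjectivity `E_N ↠ Im(Π^tp_Y)`, and exactness in the
middle `E_N ∩ Ker = μ_N(B_N)` — i.e. `1 → μ_N(B_N) → E_N → Im(Π^tp_Y) → 1` is exact, with no named input.
[cite: MochizukiEtTh2009, Lem 5.9 (ii) p.332 (PDF p.106)] -/
theorem lem59ii_ofConnectedTemperoidData :
    (ofConnectedTemperoidData h Q odd_l R ιX K' constEmb constEmb_injective hinvc hinvp).muTorsion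
          (ofConnectedTemperoidData h Q odd_l R ιX K' constEmb constEmb_injective hinvc hinvp).BN
          (ofConnectedTemperoidData h Q odd_l R ιX K' constEmb constEmb_injective hinvc hinvp).N ≤
        (ofConnectedTemperoidData h Q odd_l R ιX K' constEmb constEmb_injective hinvc hinvp).EN ∧
      (ofConnectedTemperoidData h Q odd_l R ιX K' constEmb constEmb_injective hinvc hinvp).EN.map
          ((ofConnectedTemperoidData h Q odd_l R ιX K' constEmb constEmb_injective hinvc hinvp).autBase
            (ofConnectedTemperoidData h Q odd_l R ιX K' constEmb constEmb_injective hinvc hinvp).BN) =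
        (ofConnectedTemperoidData h Q odd_l R ιX K' constEmb constEmb_injective hinvc hinvp).imPiY ∧
      (ofConnectedTemperoidData h Q odd_l R ιX K' constEmb constEmb_injective hinvc hinvp).EN ⊓
          ((ofConnectedTemperoidData h Q odd_l R ιX K' constEmb constEmb_injective hinvc hinvp).autBase
            (ofConnectedTemperoidData h Q odd_l R ιX K' constEmb constEmb_injective hinvc hinvp).BN).ker =
        (ofConnectedTemperoidData h Q odd_l R ιX K' constEmb constEmb_injective hinvc hinvp).muTorsion
          (ofConnectedTemperoidData h Q odd_l R ιX K' constEmb constEmb_injective hinvc hinvp).BN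
          (ofConnectedTemperoidData h Q odd_l R ιX K' constEmb constEmb_injective hinvc hinvp).N :=
  ⟨le_sectionSubgroup _ _ _, enExact_ofConnectedTemperoidData h Q odd_l R ιX K' constEmb constEmb_injective hinvc hinvp⟩

/-- **[EtTh] Prop. 4.3 (iii) over `B^temp(Π^tp_X)⁰`** for the bi-Kummer `N`-th root `(s^⊓-gp_N, s^⊔-gp_N)` of p. 331: the
difference `s^⊔-gp_N(h) · s^⊓-gp_N(h)⁻¹` lies in `μ_N(B_N)` for every `h ∈ H_{B_N}` (`BiKummerDifferenceMem`), MODULO the single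
printed input `hH` (`Π^tp_Ÿ ⊆ H_⊙`, §5 p. 322) — abc-iut-L2-t4's `biKummerDifferenceMem_ofBiKummerData` with `hσ` the theorem
`baseMap_strvOfBiKummerData` and the [FrdI] Thm. 5.2 (ii) dictionary laws `hfrac` / `haut` the theorems `coe_fracOfModel_mul_unit` /
`coe_biratAutModel_eq_pull` (identity dictionary).  [cite: MochizukiEtTh2009, Prop 4.3 (iii) p.317 (PDF p.91); §5 p.331 (PDF p.105)] -/
theorem biKummerDifferenceMem_ofConnectedTemperoidData
    (hH : ∀ y : T.PiX, y ∈ T.PiYdd → ιX y ∈ (BiKummerSetting.mkOfConnectedTemperoid X tf hZ hP NH A₀ hA₀ hA₀').Hodot) :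
    (ofConnectedTemperoidData h Q odd_l R ιX K' constEmb constEmb_injective hinvc hinvp).BiKummerDifferenceMem :=
  biKummerDifferenceMem_ofBiKummerData h _ Q odd_l R ιX _ _ K' constEmb constEmb_injective _ _
    (baseMap_strvOfBiKummerData h R) hH (fun s' s'' _ _ _ => BiKummerSetting.coe_fracOfModel_mul_unit tf T₀.isUnit_BΛ s' s'')
    (fun e x => BiKummerSetting.coe_biratAutModel_eq_pull tf e x)

/-- **[EtTh] Lemma 5.9 (i) over `B^temp(Π^tp_X)⁰`** (p. 331 (PDF p. 105): "`s^⊓-gp_N|_{H_{B_N}}`, `s^⊔-gp_N` factor through `E_N`"),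
MODULO `hH` alone — `sectionsFactor_of` and Prop. 4.3 (iii) above.  [cite: MochizukiEtTh2009, Lem 5.9 (i) p.331 (PDF p.105)] -/
theorem sectionsFactor_ofConnectedTemperoidData
    (hH : ∀ y : T.PiX, y ∈ T.PiYdd → ιX y ∈ (BiKummerSetting.mkOfConnectedTemperoid X tf hZ hP NH A₀ hA₀ hA₀').Hodot) :
    (ofConnectedTemperoidData h Q odd_l R ιX K' constEmb constEmb_injective hinvc hinvp).SectionsFactor :=
  sectionsFactor_of _
    (biKummerDifferenceMem_ofConnectedTemperoidData h Q odd_l R ιX K' constEmb constEmb_injective hinvc hinvp hH)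

end OfConnectedTemperoidData

/-! ### Over `B^temp(Π^tp_X)⁰` with `A_⊙^bs := Ÿ` (`mkOfConnectedTemperoidYdd`): Lemma 5.9 (i) and (ii) with NO named input -/

section OfConnectedTemperoidYddData

variable {K : Type u₀} [Field K] {X : SemiGraphs.TemperedArithmeticGroup.{u₀} K} {D₀ : Type u₀} [Category.{v₀} D₀]
  {V : FrdIMonoidStub.{w}} {T₀ : RealifiedDivisorMonoids (D₀ := D₀) V}
  {VD : FrdICatStub.{u₀ + 1, u₀, w} (ConnectedPart (BTemp X.Pi))}
  {tf : TemperedFrobenioid T₀ (ConnectedPart (BTemp X.Pi)) VD} {hZ : tf.monoidType = MonoidType.Z}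
  {hP : ∀ A : (ConnectedPart (BTemp X.Pi))ᵒᵖ, IsPerfect (tf.Φ.carrier A)}
  {NH : Subgroup (Field.absoluteGaloisGroup K) → tf.category → ℕ+ → Prop}
  {lv N : ℕ+} {T : ThetaEnvData.{max u₀ w} N} {ιX : T.PiX ≃ₜ* X.Pi}
  {pullFrac : ∀ {A A' : (BiKummerSetting.mkOfConnectedTemperoidYdd X tf hZ hP NH T ιX).C} (_ : A' ⟶ A),
    (BiKummerSetting.mkOfConnectedTemperoidYdd X tf hZ hP NH T ιX).biratUnits A →
      (BiKummerSetting.mkOfConnectedTemperoidYdd X tf hZ hP NH T ιX).biratUnits A'}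
  {θ : (BiKummerSetting.mkOfConnectedTemperoidYdd X tf hZ hP NH T ιX).biratUnits
    (BiKummerSetting.mkOfConnectedTemperoidYdd X tf hZ hP NH T ιX).Aodot}
  {Bl : (BiKummerSetting.mkOfConnectedTemperoidYdd X tf hZ hP NH T ιX).C}
  {Pl : (BiKummerSetting.mkOfConnectedTemperoidYdd X tf hZ hP NH T ιX).FractionPair θ Bl}
  {Rl : (BiKummerSetting.mkOfConnectedTemperoidYdd X tf hZ hP NH T ιX).NthRoot θ Pl lv pullFrac}
  (h : ModelFrobenioid.Hypotheses tf.divisorMonoid tf.ratFnFunctor)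
  (Q : FrobenioidTheta.ThetaSubquotientStub.{w} (ConnectedPart (BTemp X.Pi))) (odd_l : Odd (lv : ℕ))
  (R : (BiKummerSetting.mkOfConnectedTemperoidYdd X tf hZ hP NH T ιX).NthRoot Rl.root Rl.pair N pullFrac)
  (K' : Type w) [Field K'] (constEmb : K'ˣ →* tf.biratUnitsModel R.BN) (constEmb_injective : Function.Injective constEmb)
  (hinvc : ∀ g : Aut R.AN.base,
    pull tf.divisorMonoid g.hom (ModelFrobenioid.div R.pair.num) = ModelFrobenioid.div R.pair.num)
  (hinvp : ∀ y : T.PiX, y ∈ T.PiYdd →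
    pull tf.divisorMonoid ((BiKummerSetting.mkOfConnectedTemperoidYdd X tf hZ hP NH T ιX).galoisSurj R.AN.base
      R.αData.isGalois (ιX y)).hom (ModelFrobenioid.div R.pair.den) = ModelFrobenioid.div R.pair.den)

/-- **[EtTh] Prop. 4.3 (iii) with NO named input** for the §5 data over `B^temp(Π^tp_X)⁰` with `A_⊙^bs := Ÿ`: the bi-Kummer
difference of `(s^⊓-gp_N, s^⊔-gp_N)` is `μ_N(B_N)`-valued on `H_{B_N}` — `hH` is the theorem `hH_mkOfConnectedTemperoidYdd`.
[cite: MochizukiEtTh2009, Prop 4.3 (iii) p.317 (PDF p.91); §5 p.331 (PDF p.105)] -/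
theorem biKummerDifferenceMem_ofConnectedTemperoidYddData :
    (ofConnectedTemperoidData h Q odd_l R ιX K' constEmb constEmb_injective hinvc hinvp).BiKummerDifferenceMem :=
  biKummerDifferenceMem_ofConnectedTemperoidData h Q odd_l R ιX K' constEmb constEmb_injective hinvc hinvp
    (BiKummerSetting.hH_mkOfConnectedTemperoidYdd X tf hZ hP NH T ιX)

/-- **[EtTh] Lemma 5.9 (i) with NO named input** for the §5 data over `B^temp(Π^tp_X)⁰` with `A_⊙^bs := Ÿ`:
"`s^⊓-gp_N|_{H_{B_N}}`, `s^⊔-gp_N` factor through `E_N`".  [cite: MochizukiEtTh2009, Lem 5.9 (i) p.331 (PDF p.105)] -/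
theorem sectionsFactor_ofConnectedTemperoidYddData :
    (ofConnectedTemperoidData h Q odd_l R ιX K' constEmb constEmb_injective hinvc hinvp).SectionsFactor :=
  sectionsFactor_ofConnectedTemperoidData h Q odd_l R ιX K' constEmb constEmb_injective hinvc hinvp
    (BiKummerSetting.hH_mkOfConnectedTemperoidYdd X tf hZ hP NH T ιX)

/-- **[EtTh] Lemma 5.9 (ii) with NO named input** for the §5 data over `B^temp(Π^tp_X)⁰` with `A_⊙^bs := Ÿ`:
`1 → μ_N(B_N) → E_N → Im(Π^tp_Y) → 1` is exact (`ENExact`).  [cite: MochizukiEtTh2009, Lem 5.9 (ii) p.332 (PDF p.106)] -/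
theorem enExact_ofConnectedTemperoidYddData :
    (ofConnectedTemperoidData h Q odd_l R ιX K' constEmb constEmb_injective hinvc hinvp).ENExact :=
  enExact_ofConnectedTemperoidData h Q odd_l R ιX K' constEmb constEmb_injective hinvc hinvp

/-- **[EtTh] Lemma 5.9 (i) ∧ (ii) for the §5 data over the genuine connected base with `A_⊙^bs := Ÿ`** — both parts THEOREMS
of the data (inputs: `h`, `Q`, the roots `Rl`/`R`, `ιX`, the constants, the divisor invariances `hinvc`/`hinvp`; no section
hypothesis, no `Facts` bundle, no FACT-LIST name).  [cite: MochizukiEtTh2009, Lem 5.9 (i)(ii) p.331–332 (PDF pp.105–106)] -/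
theorem lem59_i_ii_ofConnectedTemperoidYddData :
    (ofConnectedTemperoidData h Q odd_l R ιX K' constEmb constEmb_injective hinvc hinvp).SectionsFactor ∧
      (ofConnectedTemperoidData h Q odd_l R ιX K' constEmb constEmb_injective hinvc hinvp).ENExact :=
  ⟨sectionsFactor_ofConnectedTemperoidYddData h Q odd_l R K' constEmb constEmb_injective hinvc hinvp,
    enExact_ofConnectedTemperoidYddData h Q odd_l R K' constEmb constEmb_injective hinvc hinvp⟩

end OfConnectedTemperoidYddData

end ThetaFrobenioid

end Literature.AnabelianGeometry.EtaleTheta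

end
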